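import Literature.AlgebraicGeometry.HodgeTheory.BlochSemiregularSpread
import HarnessLib

/-!
# Regular immersions of codimension `p` are stable under isomorphisms of the ambient scheme

Topic `Literature/AlgebraicGeometry/HodgeTheory` (home of `IsRegularImmersionOfCodim`, `BlochSemiregularSpread.lean`).
THEOREMS ONLY.

* `IsRegularImmersionOfCodim.comp_iso` — if `i : Z ⟶ X` is a regular immersion of codimension `p` (Görtz–Wedhorn
  II Def. 19.19/19.23: the ideal of `i` is generated, on an affine open neighbourhood of each point of the image, by a
  weakly regular sequence of length `p`) and `φ : X ≅ X'` is an isomorphism of schemes, then `i ≫ φ.hom : Z ⟶ X'` is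
  a regular immersion of codimension `p`. Proof: transport the affine open `U ∋ i(z)` to `φ(U)`, the regular
  sequence along the ring isomorphism `Γ(U, 𝒪_X) ≅ Γ(φ(U), 𝒪_{X'})` (Mathlib `AddEquiv.isWeaklyRegular_congr`),
  and the kernel ideal along Mathlib's `Scheme.ker_ideal_of_isPullback_of_isOpenImmersion` for the pullback
  square of the isomorphism.

This is the «model isomorphism» bookkeeping for the lci seed of the class-level named fact `BlochSemiregularSpread n p`
(whose seed `i : Z ⟶ X₀` sits on a model `e : X₀ ≅ 𝒳_{s₀}` of the fibre): the seed `i ≫ e.hom` in the fibre is again a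
regular immersion of codimension `p`. (The corresponding transport of Bloch SEMIREGULARITY, `IsBlochSemiregular`, is NOT
in the tree.)

## References

* [GortzWedhorn2023] U. Görtz, T. Wedhorn, *Algebraic Geometry II*, Def. 19.19, Def. 19.23 (regular immersions; the
  notion is local on `X` and invariant under isomorphisms by definition).
-/

noncomputable section

open CategoryTheory AlgebraicGeometry Opposite TopologicalSpace RingTheory.Sequence

universe u

namespace Literature.AlgebraicGeometry.HodgeTheory

variable {X X' Z : Scheme.{u}} {i : Z ⟶ X} {p : ℕ}

/-- **Regular immersions of codimension `p` are stable under isomorphisms of the target**: for `φ : X ≅ X'`,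
`IsRegularImmersionOfCodim i p → IsRegularImmersionOfCodim (i ≫ φ.hom) p` (the defining data — an affine open
`U ∋ i(z)` and a weakly regular sequence of length `p` generating the ideal of `i` on `U` — are carried to `φ(U)`
by the ring isomorphism `Γ(U, 𝒪_X) ≅ Γ(φ(U), 𝒪_{X'})`). [cite: GortzWedhorn2023, Def. 19.19 and Def. 19.23] -/
theorem IsRegularImmersionOfCodim.comp_iso (h : IsRegularImmersionOfCodim i p) (φ : X ≅ X') :
    IsRegularImmersionOfCodim (i ≫ φ.hom) p := by
  classical
  haveI : IsClosedImmersion i := h.isClosedImmersion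
  refine ⟨inferInstance, fun z ↦ ?_⟩
  obtain ⟨U, hzU, rs, hlen, hreg, hI⟩ := h.2 z
  -- the affine open `φ(U) ∋ φ(i z)` of `X'`
  let U' : X'.affineOpens := ⟨φ.hom ''ᵁ (U : X.Opens), U.2.image_of_isOpenImmersion φ.hom⟩
  have hzU' : (i ≫ φ.hom).base z ∈ (U' : X'.Opens) := ⟨i.base z, hzU, rfl⟩
  -- the ring isomorphism `ψ : Γ(X, U) ≅ Γ(X', φ(U))`
  let ψ : Γ(X, U) ≃+* Γ(X', (U' : X'.Opens)) := (φ.hom.appIso (U : X.Opens)).symm.commRingCatIsoToRingEquiv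
  -- the kernel ideal of `i ≫ φ.hom` on `φ(U)` is the transported kernel ideal of `i` on `U`
  have hsq : IsPullback i (𝟙 Z) φ.hom (i ≫ φ.hom) := IsPullback.of_vert_isIso ⟨by simp⟩
  have hker : i.ker.ideal U = ((i ≫ φ.hom).ker.ideal U').comap ψ.toRingHom :=
    Scheme.ker_ideal_of_isPullback_of_isOpenImmersion (i ≫ φ.hom) i (𝟙 Z) φ.hom hsq U
  refine ⟨U', hzU', rs.map ψ.toRingHom, by rw [List.length_map, hlen], ?_, ?_⟩
  · -- weak regularity along the ring isomorphism
    refine (AddEquiv.isWeaklyRegular_congr (e := ψ.toAddEquiv) ?_).1 hreg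
    exact List.forall₂_map_right_iff.2 (List.forall₂_same.2 fun r _ x ↦ by
      change ψ (r * x) = ψ r * ψ x
      exact map_mul ψ r x)
  · -- the transported generators generate the transported ideal
    rw [← Ideal.map_ofList, hI, hker]
    exact Ideal.map_comap_of_surjective ψ.toRingHom ψ.surjective _
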